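import Literature.AlgebraicTopology.Homotopy.HurewiczFibration
import Literature.AlgebraicTopology.Homotopy.HomotopyEquivWeakEquivProofs
import Mathlib.Analysis.Convex.Star
import Mathlib.Topology.Homotopy.Equiv
import HarnessLib

/-!
# Hurewicz fibrations over a contractible base: the fibre is a deformation image of the total space

Topic `Literature/AlgebraicTopology/Homotopy`, continuing `HurewiczFibration.lean`. A. Hatcher,
*Algebraic Topology* (2002), §4.2, Prop. 4.61 and its proof (p. 405: "a fibration `p : E → B`
[…] a homotopy `gₜ` […] lifting gives `L : F_{γ(0)} → F_{γ(1)}`"), Cor. 4.63 (p. 406: "a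
fibration over a contractible base is fibre homotopy equivalent to a product", whence the
inclusion of a fibre is a homotopy equivalence) and Example 4.65. What the homology of
fibrations over a cell needs is the following concrete form, PROVED here for the tree's
`IsHurewiczFibration` (homotopy lifting for all spaces):

* `IsHurewiczFibration.restrictPreimage` — the restriction `p⁻¹T → T` over a sub-base is again a
  Hurewicz fibration;
* `IsHurewiczFibration.exists_deformation` — over a base `B` with a **contraction fixing `b₀`**
  (`H : I × B → B`, `H₀ = id`, `H₁ ≡ b₀`, `Hₜ b₀ = b₀`; e.g. a star-convex subset of a real vector
  space about `b₀`, `contractionAt_of_starConvex`), lifting `(t, e) ↦ Hₜ(p e)` from the identity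
  gives `L : I × E → E` with `L₀ = id`, `p ∘ Lₜ = Hₜ ∘ p`; so `L₁` lands in the fibre
  `F = p⁻¹{b₀}` and `Lₜ` preserves `F`;
* `IsHurewiczFibration.homotopyEquivFibre` — hence **the inclusion `F ↪ E` is a homotopy
  equivalence** with inverse `e ↦ L₁ e` (Hatcher Cor. 4.63), both homotopies being `L`;
  `isWeakHomotopyEquiv_fibreInclusion`;
* `contractionAt_of_starConvex` — the straight-line contraction of a star-convex set, fixing its
  centre (the case of closed balls / cubes, the cells of a CW complex).

## References

* A. Hatcher, *Algebraic Topology*, CUP (2002), §4.2 Prop. 4.61, Cor. 4.63, Ex. 4.65 (pp. 405–407).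
  [HatcherAT2002]
-/

noncomputable section

open Set Function unitInterval
open scoped Topology unitInterval

namespace Literature.AlgebraicTopology.Homotopy

universe u v w

/-! ### Contractions fixing a point -/

/-- A **contraction of `B` to `b₀` fixing `b₀`**: a homotopy from the identity to the constant map
which keeps `b₀` fixed at all times. [folklore] -/
structure ContractionAt (B : Type v) [TopologicalSpace B] (b₀ : B) where
  /-- the homotopy `(t, b) ↦ Hₜ b` -/
  H : C(I × B, B)
  map_zero : ∀ b, H (0, b) = b
  map_one : ∀ b, H (1, b) = b₀
  map_pt : ∀ t, H (t, b₀) = b₀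

/-- **The straight-line contraction of a star-convex set** about its centre fixes the centre:
`Hₜ b = (1 - t) b + t b₀`. [folklore] -/
def contractionAt_of_starConvex {V : Type v} [AddCommGroup V] [Module ℝ V] [TopologicalSpace V]
    [IsTopologicalAddGroup V] [ContinuousSMul ℝ V] {K : Set V} {b₀ : V} (hK : StarConvex ℝ b₀ K)
    (hb₀ : b₀ ∈ K) : ContractionAt ↥K ⟨b₀, hb₀⟩ :=
  have hmem : ∀ tb : I × ↥K, (1 - (tb.1 : ℝ)) • (tb.2 : V) + (tb.1 : ℝ) • b₀ ∈ K := fun tb => by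
    have h := hK tb.2.2 tb.1.2.1 (sub_nonneg.2 tb.1.2.2) (add_sub_cancel _ _)
    rwa [add_comm] at h
  have hcont : Continuous fun tb : I × ↥K => (1 - (tb.1 : ℝ)) • (tb.2 : V) + (tb.1 : ℝ) • b₀ :=
    (((continuous_const.sub (continuous_subtype_val.comp continuous_fst)).smul
      (continuous_subtype_val.comp continuous_snd)).add
      ((continuous_subtype_val.comp continuous_fst).smul continuous_const))
  { H := ⟨fun tb => ⟨(1 - (tb.1 : ℝ)) • (tb.2 : V) + (tb.1 : ℝ) • b₀, hmem tb⟩, hcont.subtype_mk _⟩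
    map_zero := fun b => Subtype.ext (by
      show (1 - ((0 : I) : ℝ)) • (b : V) + ((0 : I) : ℝ) • b₀ = b
      simp)
    map_one := fun b => Subtype.ext (by
      show (1 - ((1 : I) : ℝ)) • (b : V) + ((1 : I) : ℝ) • b₀ = b₀
      simp)
    map_pt := fun t => Subtype.ext (by
      show (1 - (t : ℝ)) • b₀ + (t : ℝ) • b₀ = b₀
      rw [← add_smul, sub_add_cancel, one_smul]) }

namespace IsHurewiczFibration

variable {E : Type u} {B : Type v} [TopologicalSpace E] [TopologicalSpace B] {p : E → B}

/-! ### Restriction over a sub-base -/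

/-- **The restriction of a Hurewicz fibration over a sub-base is a Hurewicz fibration.**
[cite: HatcherAT2002, §4.2 p. 406] -/
theorem restrictPreimage (h : IsHurewiczFibration.{u, v, w} p) (T : Set B) :
    IsHurewiczFibration.{u, v, w} (T.restrictPreimage p) := by
  refine ⟨h.continuous.restrictPreimage, fun W _ g G hG => ?_⟩
  obtain ⟨L, hL0, hL⟩ := h.exists_lift ((⟨Subtype.val, continuous_subtype_val⟩ : C(↥(p ⁻¹' T), E)).comp g)
    ((⟨Subtype.val, continuous_subtype_val⟩ : C(↥T, B)).comp G) (fun x => by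
      show (G (0, x) : B) = p (g x : E)
      rw [hG x]; rfl)
  have hmem : ∀ tx, L tx ∈ p ⁻¹' T := fun tx => by
    show p (L tx) ∈ T
    rw [hL tx]; exact (G tx).2
  refine ⟨⟨fun tx => ⟨L tx, hmem tx⟩, L.continuous.subtype_mk _⟩, fun x => Subtype.ext (hL0 x), fun tx =>
    Subtype.ext (hL tx)⟩

/-! ### Lifting a contraction of the base -/

section Contraction

variable {b₀ : B}

/-- **Lifting a contraction fixing `b₀`**: a deformation `L` of the total space over it, starting
at the identity (Hatcher 2002, proof of Prop. 4.61 / Cor. 4.63). [cite: HatcherAT2002, §4.2 Prop. 4.61, Cor. 4.63] -/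
theorem exists_deformation (h : IsHurewiczFibration.{u, v, u} p) (c : ContractionAt B b₀) :
    ∃ L : C(I × E, E), (∀ e, L (0, e) = e) ∧ ∀ t e, p (L (t, e)) = c.H (t, p e) := by
  obtain ⟨L, hL0, hL⟩ := h.exists_lift (ContinuousMap.id E)
    (c.H.comp ((ContinuousMap.id I).prodMap ⟨p, h.continuous⟩)) (fun e => by
      show c.H (0, p e) = p e
      exact c.map_zero (p e))
  exact ⟨L, hL0, fun t e => hL (t, e)⟩

variable (h : IsHurewiczFibration.{u, v, u} p) (c : ContractionAt B b₀)

/-- The lifted deformation `L : I × E → E` (a choice). [folklore] -/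
def deform : C(I × E, E) := (exists_deformation h c).choose

/-- `L₀ = id`. [folklore] -/
theorem deform_zero (e : E) : deform h c (0, e) = e := (exists_deformation h c).choose_spec.1 e

/-- `p ∘ Lₜ = Hₜ ∘ p`. [folklore] -/
theorem apply_deform (t : I) (e : E) : p (deform h c (t, e)) = c.H (t, p e) :=
  (exists_deformation h c).choose_spec.2 t e

/-- `L₁` lands in the fibre over `b₀`. [folklore] -/
theorem deform_one_mem (e : E) : deform h c (1, e) ∈ p ⁻¹' {b₀} := by
  show p (deform h c (1, e)) ∈ ({b₀} : Set B)
  rw [apply_deform h c, c.map_one]; rfl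

/-- `Lₜ` preserves the fibre over `b₀` (the contraction fixes `b₀`). [folklore] -/
theorem deform_mem_of_mem (t : I) {e : E} (he : e ∈ p ⁻¹' {b₀}) : deform h c (t, e) ∈ p ⁻¹' {b₀} := by
  have he' : p e = b₀ := he
  show p (deform h c (t, e)) ∈ ({b₀} : Set B)
  rw [apply_deform h c, he', c.map_pt]; rfl

/-- The retraction `E → F = p⁻¹{b₀}`, `e ↦ L₁ e`. [cite: HatcherAT2002, §4.2 Prop. 4.61] -/
def retractFibre : C(E, ↥(p ⁻¹' {b₀})) :=
  ⟨fun e => ⟨deform h c (1, e), deform_one_mem h c e⟩, (((deform h c).continuous.comp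
    (continuous_const.prodMk continuous_id))).subtype_mk _⟩

/-- `retractFibre` on points. [folklore] -/
@[simp] theorem coe_retractFibre (e : E) : (retractFibre h c e : E) = deform h c (1, e) := rfl

/-- **The inclusion of the fibre is a homotopy equivalence** over a base with a contraction fixing
the base point (Hatcher 2002, Cor. 4.63: a fibration over a contractible base is fibre-homotopy
trivial), with inverse `retractFibre` and both homotopies given by the lifted deformation `L`.
[cite: HatcherAT2002, §4.2 Cor. 4.63] -/
def homotopyEquivFibre : ContinuousMap.HomotopyEquiv ↥(p ⁻¹' {b₀}) E where
  toFun := ⟨Subtype.val, continuous_subtype_val⟩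
  invFun := retractFibre h c
  left_inv :=
    ⟨ContinuousMap.Homotopy.symm
      { toFun := fun tx => ⟨deform h c (tx.1, (tx.2 : E)), deform_mem_of_mem h c tx.1 tx.2.2⟩
        continuous_toFun := ((deform h c).continuous.comp (continuous_fst.prodMk
          (continuous_subtype_val.comp continuous_snd))).subtype_mk _
        map_zero_left := fun x => Subtype.ext (deform_zero h c x)
        map_one_left := fun _ => rfl }⟩
  right_inv :=
    ⟨ContinuousMap.Homotopy.symm
      { toFun := fun te => deform h c te
        continuous_toFun := (deform h c).continuous
        map_zero_left := fun e => deform_zero h c e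
        map_one_left := fun _ => rfl }⟩

include h c in
/-- Hence the inclusion of the fibre is a weak homotopy equivalence (bijective on all homotopy
groups). [cite: HatcherAT2002, §4.2 Cor. 4.63] -/
theorem isWeakHomotopyEquiv_fibreInclusion :
    IsWeakHomotopyEquiv (⟨Subtype.val, continuous_subtype_val⟩ : C(↥(p ⁻¹' {b₀}), E)) :=
  isWeakHomotopyEquiv_homotopyEquiv (homotopyEquivFibre h c)

/-- And the retraction is a weak homotopy equivalence. [cite: HatcherAT2002, §4.2 Cor. 4.63] -/
theorem isWeakHomotopyEquiv_retractFibre : IsWeakHomotopyEquiv (retractFibre h c) :=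
  isWeakHomotopyEquiv_homotopyEquiv (homotopyEquivFibre h c).symm

end Contraction

end IsHurewiczFibration

end Literature.AlgebraicTopology.Homotopy
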